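import Mathlib
import HarnessLib
import Summits.ResolutionOfSingularities.ResolutionOfSingularities.Theorems.HomologicalConductorPersistenceFaithfullyFlatDescent

/-!
# Crux `Persistence` (stmt-ResolutionOfSingularities-16484), chain W4.4b — U7 (part 1/2): the
# STABLE ANNIHILATOR of the cokernel of a square matrix, over any commutative ring

Route `ResolutionOfSingularities/HomologicalConductor`.  OURS (cell res-hironaka, crux chain W4.4b,
CRUX-PLAN w44b v11.1/v11.1a §H2L / §U7, planner res-L1-w44b-plan-1; seat res-D-pv-058); nothing
here is a statement of the manuscript under review (Hironaka 2017); AI-written, weaker than expert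
review.  Part 2 (`…PersistenceStableAnnihilatorMF.lean`) specialises to matrix-factorisation
modules over `S ⧸ (f)`.

For a square matrix `φ` over a commutative ring `T` and `x ∈ T`, with
`coker φ := (n → T) ⧸ range φ.mulVecLin` and `StablyAnnihilates` the tree's stable annihilator
(`NoZeno.SandwichCluster.StablyAnnihilates`: `x • 𝟙` factors through a finitely generated
projective):

* `stablyAnnihilates_coker_iff_exists_matrix` — **`x ∈ s̲ann(coker φ) ↔ ∃ C E, C φ = 0 ∧
  x • 1 = C + φ E`** (a lift `σ` of `x • 𝟙` along `Tⁿ ↠ coker φ`, sibling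
  `stablyAnnihilates_iff_exists_comp_eq_smul_id`, IS a matrix `C = σ ∘ π` with `C φ = 0` and
  `C ≡ x • 1 mod φ·Mat`, and conversely);
* `stablyAnnihilates_coker_iff_exists_mul_mul_eq` — the sandwich form `↔ ∃ B, φ B φ = x • φ`
  (sibling `exists_comp_eq_smul_id_iff_exists_sandwich`);
* `stablyAnnihilates_coker_of_mul_eq_zero` — `ψ φ = 0` and `x • 1 = G ψ + φ E` imply
  `x ∈ s̲ann(coker φ)`;
* plumbing: `mulVecLin_smul/neg/sub`, `mulVecLin_injective`, `exists_mul_eq_of_range_le` (a linear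
  map `Tⁿ → Tⁿ` with values in `range ψ` is `ψ C`).

Reference: S. B. Iyengar, R. Takahashi, *Annihilation of cohomology and strong generation of module
categories*, arXiv:1404.1476, Remark 2.13 [`IyengarTakahashi2014`] (stable annihilation = lifting
along a projective cover).  Folklore linear algebra over commutative rings.
-/

noncomputable section

-- single-problem summit: the doubled namespace component `ResolutionOfSingularities` is forced
set_option linter.dupNamespace false

open CategoryTheory
open Summit.ResolutionOfSingularities.ResolutionOfSingularities.Theorems.NoZeno.SandwichCluster
open Summit.ResolutionOfSingularities.ResolutionOfSingularities.Theorems.HomologicalConductor.PersistenceFaithfullyFlatDescent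

universe u

namespace Summit.ResolutionOfSingularities.ResolutionOfSingularities.Theorems.HomologicalConductor.PersistenceStableAnnihilatorMatrix

section Core

variable {T : Type u} [CommRing T] {n : Type} [Fintype n]

/-- `mulVecLin` is compatible with scalars: `(x • φ).mulVecLin = x • φ.mulVecLin`. [folklore] -/
theorem mulVecLin_smul (x : T) (φ : Matrix n n T) : (x • φ).mulVecLin = x • φ.mulVecLin := by
  refine LinearMap.ext fun v => ?_
  simp

/-- `mulVecLin` is compatible with negation: `(-φ).mulVecLin = -φ.mulVecLin`. [folklore] -/
theorem mulVecLin_neg (φ : Matrix n n T) : (-φ).mulVecLin = -φ.mulVecLin := by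
  refine LinearMap.ext fun v => ?_
  simp

/-- `mulVecLin` is compatible with subtraction. [folklore] -/
theorem mulVecLin_sub (φ ψ : Matrix n n T) : (φ - ψ).mulVecLin = φ.mulVecLin - ψ.mulVecLin := by
  refine LinearMap.ext fun v => ?_
  simp

variable [DecidableEq n]

/-- `mulVecLin` is injective on square matrices (it is the linear equivalence `Matrix.toLin'`).
[folklore] -/
theorem mulVecLin_injective : Function.Injective (fun φ : Matrix n n T => φ.mulVecLin) := by
  intro φ ψ h
  have : Matrix.toLin' φ = Matrix.toLin' ψ := by simpa [Matrix.toLin'_apply'] using h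
  exact Matrix.toLin'.injective this

/-- A linear map on `n → T` with values in the range of `ψ` is `ψ C` for some matrix `C` (`Tⁿ` is
projective). [folklore] -/
theorem exists_mul_eq_of_range_le (ψ N : Matrix n n T)
    (h : LinearMap.range N.mulVecLin ≤ LinearMap.range ψ.mulVecLin) :
    ∃ C : Matrix n n T, ψ * C = N := by
  have hmem : ∀ v, N.mulVecLin v ∈ LinearMap.range ψ.mulVecLin := fun v => h ⟨v, rfl⟩
  obtain ⟨g, hg⟩ := Module.projective_lifting_property ψ.mulVecLin.rangeRestrict
    (LinearMap.codRestrict (LinearMap.range ψ.mulVecLin) N.mulVecLin hmem)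
    ψ.mulVecLin.surjective_rangeRestrict
  refine ⟨LinearMap.toMatrix' g, ?_⟩
  apply mulVecLin_injective
  simp only
  have hg' : (LinearMap.toMatrix' g).mulVecLin = g := by
    rw [← Matrix.toLin'_apply', Matrix.toLin'_toMatrix']
  rw [Matrix.mulVecLin_mul, hg']
  refine LinearMap.ext fun v => ?_
  have h1 := congrArg Subtype.val (LinearMap.congr_fun hg v)
  simpa using h1

/-- **The criterion in matrix form, over any commutative ring.**  For a square matrix `φ` over `T`
and `x ∈ T`: `x` stably annihilates `coker φ = (n → T) ⧸ range φ` iff there are matrices `C`, `E`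
with `C φ = 0` and `x • 1 = C + φ E`.  (`⇒`: a lift `σ : coker φ → Tⁿ` of `x • 𝟙` along the
projection `π` — sibling `stablyAnnihilates_iff_exists_comp_eq_smul_id` — gives the matrix
`C := σ ∘ π` with `C φ = σ π φ = 0` and `π C = x • π`, so `C - x • 1` takes values in
`ker π = range φ` and equals `φ (-E)`; `⇐`: `C` kills `range φ`, descends to `σ`, and
`π σ π = π C = π (x • 1 + φ E) = x • π`.) [cite: IyengarTakahashi2014, Remark 2.13] -/
theorem stablyAnnihilates_coker_iff_exists_matrix (φ : Matrix n n T) (x : T) :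
    StablyAnnihilates T x (ModuleCat.of T ((n → T) ⧸ LinearMap.range φ.mulVecLin)) ↔
      ∃ C E : Matrix n n T, C * φ = 0 ∧ x • (1 : Matrix n n T) = C + φ * E := by
  rw [stablyAnnihilates_iff_exists_comp_eq_smul_id x (LinearMap.range φ.mulVecLin).mkQ
      (Submodule.mkQ_surjective _)]
  constructor
  · rintro ⟨σ, hσ⟩
    set C : Matrix n n T := LinearMap.toMatrix' (σ ∘ₗ (LinearMap.range φ.mulVecLin).mkQ) with hC
    have hCγ : C.mulVecLin = σ ∘ₗ (LinearMap.range φ.mulVecLin).mkQ := by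
      rw [hC, ← Matrix.toLin'_apply', Matrix.toLin'_toMatrix']
    have hCφ : C * φ = 0 := by
      apply mulVecLin_injective
      simp only
      rw [Matrix.mulVecLin_mul, hCγ, LinearMap.comp_assoc, LinearMap.range_mkQ_comp,
        LinearMap.comp_zero, Matrix.mulVecLin_zero]
    have hrange : LinearMap.range (C - x • (1 : Matrix n n T)).mulVecLin ≤
        LinearMap.range φ.mulVecLin := by
      rintro _ ⟨v, rfl⟩
      rw [← Submodule.ker_mkQ (LinearMap.range φ.mulVecLin), LinearMap.mem_ker, mulVecLin_sub,
        mulVecLin_smul, Matrix.mulVecLin_one, hCγ, LinearMap.sub_apply, LinearMap.comp_apply,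
        LinearMap.smul_apply, LinearMap.id_apply, map_sub, map_smul]
      have h1 : (LinearMap.range φ.mulVecLin).mkQ (σ ((LinearMap.range φ.mulVecLin).mkQ v)) =
          x • (LinearMap.range φ.mulVecLin).mkQ v := by
        simpa using LinearMap.congr_fun hσ ((LinearMap.range φ.mulVecLin).mkQ v)
      rw [h1, sub_self]
    obtain ⟨E, hE⟩ := exists_mul_eq_of_range_le φ _ hrange
    exact ⟨C, -E, hCφ, by rw [Matrix.mul_neg, hE]; abel⟩
  · rintro ⟨C, E, hCφ, hx⟩
    have hker : LinearMap.range φ.mulVecLin ≤ LinearMap.ker C.mulVecLin := by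
      rintro _ ⟨v, rfl⟩
      rw [LinearMap.mem_ker, ← LinearMap.comp_apply, ← Matrix.mulVecLin_mul, hCφ,
        Matrix.mulVecLin_zero, LinearMap.zero_apply]
    refine ⟨(LinearMap.range φ.mulVecLin).liftQ C.mulVecLin hker, ?_⟩
    apply Submodule.linearMap_qext
    have hC' : C = x • (1 : Matrix n n T) - φ * E := by rw [hx]; abel
    rw [LinearMap.comp_assoc, Submodule.liftQ_mkQ, hC', mulVecLin_sub, mulVecLin_smul,
      Matrix.mulVecLin_one, Matrix.mulVecLin_mul, LinearMap.comp_sub, ← LinearMap.comp_assoc,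
      LinearMap.range_mkQ_comp, LinearMap.zero_comp, sub_zero, LinearMap.comp_smul,
      LinearMap.smul_comp, LinearMap.comp_id, LinearMap.id_comp]

/-- **The sandwich in matrix form.**  For a square matrix `φ` over a commutative ring `T` and
`x ∈ T`: `x` stably annihilates `coker φ` iff `φ B φ = x • φ` for some matrix `B` (presentation
`Tⁿ —φ→ Tⁿ ↠ coker φ`, sibling `stablyAnnihilates_iff_exists_comp_eq_smul_id` +
`exists_comp_eq_smul_id_iff_exists_sandwich`, and every endomorphism of `Tⁿ` is a matrix).
[cite: IyengarTakahashi2014, Remark 2.13] -/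
theorem stablyAnnihilates_coker_iff_exists_mul_mul_eq (φ : Matrix n n T) (x : T) :
    StablyAnnihilates T x (ModuleCat.of T ((n → T) ⧸ LinearMap.range φ.mulVecLin)) ↔
      ∃ B : Matrix n n T, φ * B * φ = x • φ := by
  rw [stablyAnnihilates_iff_exists_comp_eq_smul_id x (LinearMap.range φ.mulVecLin).mkQ
      (Submodule.mkQ_surjective _),
    exists_comp_eq_smul_id_iff_exists_sandwich x φ.mulVecLin (LinearMap.range φ.mulVecLin).mkQ
      (LinearMap.exact_map_mkQ_range φ.mulVecLin) (Submodule.mkQ_surjective _)]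
  constructor
  · rintro ⟨β, hβ⟩
    refine ⟨-LinearMap.toMatrix' β, ?_⟩
    apply mulVecLin_injective
    simp only
    have hB : (-LinearMap.toMatrix' β).mulVecLin = -β := by
      rw [← Matrix.toLin'_apply', map_neg, Matrix.toLin'_toMatrix']
    rw [Matrix.mulVecLin_mul, Matrix.mulVecLin_mul, mulVecLin_smul, hB, LinearMap.comp_neg,
      LinearMap.neg_comp, LinearMap.comp_assoc, hβ, neg_neg]
  · rintro ⟨B, hB⟩
    refine ⟨(-B).mulVecLin, ?_⟩
    rw [← Matrix.mulVecLin_mul, ← Matrix.mulVecLin_mul, ← mulVecLin_smul, ← mulVecLin_neg,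
      Matrix.neg_mul, Matrix.mul_neg, ← Matrix.mul_assoc, hB]

/-- If `ψ φ = 0` and `x • 1 = G ψ + φ E` for some matrices `G`, `E`, then `x` stably annihilates
`coker φ` (`C := G ψ` kills `φ`). [folklore] -/
theorem stablyAnnihilates_coker_of_mul_eq_zero (φ ψ G E : Matrix n n T) (hψφ : ψ * φ = 0) (x : T)
    (hx : x • (1 : Matrix n n T) = G * ψ + φ * E) :
    StablyAnnihilates T x (ModuleCat.of T ((n → T) ⧸ LinearMap.range φ.mulVecLin)) :=
  (stablyAnnihilates_coker_iff_exists_matrix φ x).mpr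
    ⟨G * ψ, E, by rw [Matrix.mul_assoc, hψφ, Matrix.mul_zero], hx⟩

end Core

end Summit.ResolutionOfSingularities.ResolutionOfSingularities.Theorems.HomologicalConductor.PersistenceStableAnnihilatorMatrix
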